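import Literature.AlgebraicTopology.CharacteristicClasses.ProjectiveBundleLocalLH
import Literature.AlgebraicTopology.CharacteristicClasses.GaussMap
import Literature.AlgebraicTopology.CharacteristicClasses.ProjectivizationHomotopy
import Literature.AlgebraicTopology.CharacteristicClasses.ProjectiveLine
import Literature.AlgebraicTopology.CharacteristicClasses.ProjectiveSpaceMetrizable
import Literature.AlgebraicTopology.CharacteristicClasses.ProjectiveSpaceLowHomology
import Literature.AlgebraicTopology.CharacteristicClasses.TopologicalChernClasses
import Literature.AlgebraicTopology.SingularHomology.CohomologyHomotopyInvariance
import HarnessLib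

/-!
# A pure degree-two class on the projective bundle: the Gauss map to `ℙ(ℓ²)` and `c₁` of the tautological bundle

Topic `Literature/AlgebraicTopology/CharacteristicClasses`. D. Husemoller, *Fibre Bundles*, 3rd
ed. (1994), Ch. 17 §2: the class `a_ξ ∈ H²(E(Pξ))` of the Leray–Hirsch argument is the first
Chern class of the canonical line bundle `λ_ξ`, i.e. `a_ξ = g*(c₁(γ))` for a classifying map
`g : E(Pξ) → ℂP^∞` of `λ_ξ`; restricted to a fibre `ℂPⁿ⁻¹` it is the generator (Thm. 2.5, (2.3)).
Ch. 3 §5 Prop. 5.8: Gauss maps over paracompact bases. A. Hatcher, *Algebraic Topology* (2002),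
§3.1 p. 201 (homotopy invariance).

For a complex vector bundle `E` over a paracompact Hausdorff `B` and a theory of Chern classes `C`
(`ChernClassTheory`), we construct

* the Gauss map `gaussData E : E → K = ℓ²((B × Fin n) ⊕ Fin n)` supported on the first summand
  (`gaussData_apply_inr`), and the reference injection `refMap : F → K` supported on the second;
* the classifying-type map **`gaussProj E : P(E) → ℙ(K)`, `⟨b, ℓ⟩ ↦ ℙ(G_b) ℓ`** (continuous,
  `continuous_gaussProj`), and the class **`gaussClass C E = (gaussProj E)* c₁^C(γ_K) ∈ H²(P(E); ℤ)`**;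
* **purity** (`map_projChartInv_gaussClass`): over a trivialising `U ⊆ e.baseSet`,
  `(projChartInv)* (gaussClass C E) = pr₂* (refClass C E)` with
  `refClass C E = ℙ(refMap)* c₁^C(γ_K) ∈ H²(ℙ ℂ F; ℤ)` — the maps `(b, ℓ) ↦ ℙ(G_b ẽ_b⁻¹) ℓ` and
  `(b, ℓ) ↦ ℙ(refMap) ℓ` are homotopic through `ℙ(t G_b ẽ_b⁻¹ + (1 - t) refMap)` (injective by
  the disjoint supports), and cohomology is homotopy invariant;
* **`span_refClass_eq_top`**: `refClass C E` generates `H²(ℙ ℂ F; ℤ)` for `rank E ≥ 2` — along the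
  projective line through `refMap e₀, refMap e₁` the class `c₁^C(γ_K)` restricts to `c₁^C(γ¹)`, a
  generator ((C₃) and `tautologicalLineBundleIsoPullback`), and `H²(ℙ ℂ F) ≅ ℤ ≅ H²(ℂP¹)`.

Everything is proved; no named facts.

## References

* [HusemollerFibreBundles1994] D. Husemoller, *Fibre Bundles*, 3rd ed. (1994), Ch. 17 §2 (2.3),
  Thm. 2.5; Ch. 3 §5 Prop. 5.8.
* [HatcherAT2002] A. Hatcher, *Algebraic Topology*, CUP 2002, §3.1 p. 201.
-/

noncomputable section

open CategoryTheory Function Set Module Bundle Topology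
open Literature.AlgebraicTopology.SingularHomology Literature.Topology.FourManifolds
open scoped LinearAlgebra.Projectivization unitInterval lp InnerProductSpace OnePoint

namespace Literature.AlgebraicTopology.CharacteristicClasses

/-! ### The Hilbert space, the supported Gauss map and the reference injection -/

section Gauss

variable {B : Type} [TopologicalSpace B] (E : ComplexVectorBundle.{0, 0} B)

/-- The index type `(B × Fin n) ⊕ Fin n` of the Hilbert space. [folklore] -/
abbrev GIdx : Type := (B × Fin (Module.finrank ℂ E.F)) ⊕ Fin (Module.finrank ℂ E.F)

/-- The Hilbert space `K = ℓ²((B × Fin n) ⊕ Fin n, ℂ)` — a model of `ℂ^∞`. [cite: HusemollerFibreBundles1994, Ch. 3 §5 Prop. 5.8] -/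
abbrev GH : Type := ℓ²(GIdx E, ℂ)

/-- A partition of unity subordinate to the canonical trivialising cover (paracompact base). [folklore] -/
theorem exists_partition [T2Space B] [ParacompactSpace B] :
    ∃ ρ : PartitionOfUnity B B, ρ.IsSubordinate fun i ↦ (trivializationAt E.F E.E i).baseSet :=
  PartitionOfUnity.exists_isSubordinate isClosed_univ (fun i : B ↦ (trivializationAt E.F E.E i).baseSet)
    (fun i ↦ (trivializationAt E.F E.E i).open_baseSet) fun b _ ↦ mem_iUnion.2 ⟨b, mem_baseSet_trivializationAt E.F E.E b⟩

/-- **The Gauss map `E → K` supported on the first summand of the index type** (Husemoller Ch. 3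
§5 Prop. 5.8, with the coordinates placed at the indices `inl (i, r)`). [cite: HusemollerFibreBundles1994, Ch. 3 §5 Prop. 5.8] -/
def gaussData [T2Space B] [ParacompactSpace B] : GaussMap ℂ E.F E.E (GH E) := by
  classical
  exact gaussMapOfPartition (Classical.choose (exists_partition E)) (Sum.inl : B × Fin (Module.finrank ℂ E.F) → GIdx E)
    (Classical.choose_spec (exists_partition E)) Sum.inl_injective

/-- A coordinate block has no coordinates outside the image of its embedding. [folklore] -/
theorem coordBlock_apply_of_forall_ne {ι : Type} [DecidableEq ι] (emb : B × Fin (Module.finrank ℂ E.F) → ι) (i : B) (x : E.F)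
    (k : ι) (hk : ∀ r, emb (i, r) ≠ k) : (coordBlock emb i x : ℓ²(ι, ℂ)) k = 0 := by
  rw [coordBlock_apply_apply]
  exact Finset.sum_eq_zero fun r _ ↦ lpSingle_apply_ne _ _ fun h ↦ hk r h.symm

/-- **The Gauss map vanishes at the indices of the second summand.** [folklore] -/
theorem gaussData_apply_inr [T2Space B] [ParacompactSpace B] (b : B) (v : E.E b) (r : Fin (Module.finrank ℂ E.F)) :
    ((gaussData E).fiberMap b v : GH E) (Sum.inr r) = 0 := by
  classical
  change (gaussFiberMap (𝕜 := ℂ) (Classical.choose (exists_partition E))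
    (Sum.inl : B × Fin (Module.finrank ℂ E.F) → GIdx E) b v : GH E) (Sum.inr r) = 0
  rw [gaussFiberMap, LinearMap.sum_apply, lp.coeFn_sum, Finset.sum_apply]
  refine Finset.sum_eq_zero fun i _ ↦ ?_
  rw [LinearMap.smul_apply, lp.coeFn_smul, Pi.smul_apply, LinearMap.comp_apply, ContinuousLinearMap.coe_coe,
    coordBlock_apply_of_forall_ne E _ i _ _ (fun r' h ↦ Sum.inl_ne_inr h), smul_zero]

/-- **The reference injection `F → K`, `x ↦ Σ_r x_r δ_{inr r}`**, supported on the second summand. [folklore] -/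
def refMap : E.F →L[ℂ] GH E :=
  haveI := Classical.decEq B
  ∑ r, (lpSingle (Sum.inr r : GIdx E)).comp (fiberCoord r)

/-- The coordinates of the reference injection. [folklore] -/
theorem refMap_apply_apply (x : E.F) (k : GIdx E) :
    haveI := Classical.decEq B
    (refMap E x : GH E) k = ∑ r, (lpSingle (Sum.inr r : GIdx E) ((Module.finBasis ℂ E.F).repr x r) : GH E) k := by
  classical
  rw [refMap, FunLike.coe_sum, Finset.sum_apply, lp.coeFn_sum, Finset.sum_apply]
  rfl

/-- The reference injection recovers the coordinates at the second summand. [folklore] -/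
theorem refMap_apply_inr (x : E.F) (r : Fin (Module.finrank ℂ E.F)) :
    (refMap E x : GH E) (Sum.inr r) = (Module.finBasis ℂ E.F).repr x r := by
  classical
  rw [refMap_apply_apply, Finset.sum_eq_single r, lpSingle_apply_self]
  · intro r' _ hr'
    exact lpSingle_apply_ne _ _ fun h ↦ hr' (Sum.inr_injective h).symm
  · exact fun h ↦ (h (Finset.mem_univ r)).elim

/-- The reference injection vanishes at the first summand. [folklore] -/
theorem refMap_apply_inl (x : E.F) (p : B × Fin (Module.finrank ℂ E.F)) : (refMap E x : GH E) (Sum.inl p) = 0 := by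
  classical
  rw [refMap_apply_apply]
  exact Finset.sum_eq_zero fun r _ ↦ lpSingle_apply_ne _ _ Sum.inl_ne_inr

/-- **The reference injection is injective.** [folklore] -/
theorem refMap_injective : Injective (refMap E) := by
  intro x y h
  refine eq_of_fiberCoord_eq (𝕜 := ℂ) fun r ↦ ?_
  rw [fiberCoord_apply, fiberCoord_apply, ← refMap_apply_inr, ← refMap_apply_inr, h]

end Gauss

/-! ### The local linear maps and the straight-line homotopy of injections -/

section Local

open ComplexVectorBundle

variable {B : Type} [TopologicalSpace B] [T2Space B] [ParacompactSpace B] (E : ComplexVectorBundle.{0, 0} B)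
  (e : Trivialization E.F (π E.F E.E)) [MemTrivializationAtlas e]

/-- **The local expression `A_b = G_b ∘ ẽ_b⁻¹ : F → K` of the Gauss map** in the trivialisation `e`. [folklore] -/
def locMap (b : B) : E.F →ₗ[ℂ] GH E :=
  (gaussData E).fiberMap b ∘ₗ ((linEquivAt ℂ E.F E.E e b).symm : E.F →ₗ[ℂ] E.E b)

/-- The local expression is injective. [folklore] -/
theorem locMap_injective (b : B) : Injective (locMap E e b) :=
  ((gaussData E).injective b).comp (linEquivAt ℂ E.F E.E e b).symm.injective

/-- The local expression vanishes at the second summand. [folklore] -/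
theorem locMap_apply_inr (b : B) (x : E.F) (r : Fin (Module.finrank ℂ E.F)) : (locMap E e b x : GH E) (Sum.inr r) = 0 :=
  gaussData_apply_inr E b _ r

/-- **The straight-line family `H_{t,b} = t A_b + (1 - t) refMap : F → K`.** [folklore] -/
def homMap (t : ℝ) (b : B) : E.F →ₗ[ℂ] GH E :=
  ((t : ℂ)) • locMap E e b + ((1 - t : ℝ) : ℂ) • (refMap E : E.F →ₗ[ℂ] GH E)

/-- At `t = 0` the family is the reference injection. [folklore] -/
theorem homMap_zero (b : B) : homMap E e 0 b = (refMap E : E.F →ₗ[ℂ] GH E) := by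
  rw [homMap, Complex.ofReal_zero, zero_smul, zero_add, sub_zero, Complex.ofReal_one, one_smul]

/-- At `t = 1` the family is the local expression of the Gauss map. [folklore] -/
theorem homMap_one (b : B) : homMap E e 1 b = locMap E e b := by
  rw [homMap, Complex.ofReal_one, one_smul, sub_self, Complex.ofReal_zero, zero_smul, add_zero]

/-- **The straight-line family consists of injections** for `t ∈ [0, 1]`: the two summands have
disjoint supports in the index type. [folklore] -/
theorem homMap_injective {t : ℝ} (ht0 : 0 ≤ t) (ht1 : t ≤ 1) (b : B) : Injective (homMap E e t b) := by
  intro x y hxy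
  rw [← sub_eq_zero] at hxy ⊢
  rw [← map_sub] at hxy
  set z := x - y with hz
  -- coordinates of `H z = 0`
  have hco : ∀ k, (t : ℂ) * (locMap E e b z : GH E) k + ((1 - t : ℝ) : ℂ) * (refMap E z : GH E) k = 0 := fun k ↦ by
    have := congrArg (fun w : GH E ↦ w k) hxy
    simpa only [homMap, LinearMap.add_apply, LinearMap.smul_apply, ContinuousLinearMap.coe_coe, lp.coeFn_add,
      lp.coeFn_smul, Pi.add_apply, Pi.smul_apply, smul_eq_mul, lp.coeFn_zero, Pi.zero_apply] using this
  by_cases ht : t = 0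
  · -- `refMap z = 0`, hence `z = 0`
    subst ht
    refine eq_of_fiberCoord_eq (𝕜 := ℂ) fun r ↦ ?_
    rw [fiberCoord_apply, fiberCoord_apply, map_zero, Finsupp.zero_apply, ← refMap_apply_inr]
    have := hco (Sum.inr r)
    rw [Complex.ofReal_zero, zero_mul, zero_add, sub_zero, Complex.ofReal_one, one_mul] at this
    exact this
  · -- `locMap z = 0`
    apply locMap_injective E e b
    rw [map_zero]
    apply lp.ext
    funext k
    rw [lp.coeFn_zero, Pi.zero_apply]
    rcases k with p | r
    · have := hco (Sum.inl p)
      rw [refMap_apply_inl, mul_zero, add_zero] at this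
      exact (mul_eq_zero.1 this).resolve_left (by exact_mod_cast ht)
    · exact locMap_apply_inr E e b z r

/-- The local expression composed with the fibre isomorphism is the Gauss map on the fibre. [folklore] -/
theorem locMap_comp_linEquivAt (b : B) :
    locMap E e b ∘ₗ ((linEquivAt ℂ E.F E.E e b : E.E b →L[ℂ] E.F) : E.E b →ₗ[ℂ] E.F) = (gaussData E).fiberMap b := by
  apply LinearMap.ext
  intro v
  change (gaussData E).fiberMap b ((linEquivAt ℂ E.F E.E e b).symm (linEquivAt ℂ E.F E.E e b v)) = _
  rw [ContinuousLinearEquiv.symm_apply_apply]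

/-- **Joint continuity of `z ↦ A_{β z} (ξ z)` for continuous `β : Z → e.baseSet`, `ξ : Z → F`**
(it is the Gauss map after the inverse trivialisation). [folklore] -/
theorem continuous_locMap_apply {Z : Type} [TopologicalSpace Z] {β : Z → B} (hβ : Continuous β)
    (hβe : ∀ z, β z ∈ e.baseSet) {ξ : Z → E.F} (hξ : Continuous ξ) :
    Continuous fun z ↦ locMap E e (β z) (ξ z) := by
  have heq : (fun z ↦ locMap E e (β z) (ξ z)) =
      fun z ↦ (gaussData E).toFun (TotalSpace.mk' E.F (β z) (e.symm (β z) (ξ z))) := by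
    funext z
    change (gaussData E).fiberMap (β z) ((linEquivAt ℂ E.F E.E e (β z)).symm (ξ z)) = _
    rw [(gaussData E).apply_mk, linEquivAt_symm_apply e (hβe z)]
  rw [heq]
  exact (gaussData E).continuous.comp (e.continuousOn_symm.comp_continuous (hβ.prodMk hξ) fun z ↦ ⟨hβe z, mem_univ _⟩)

/-- **Joint continuity of `((t, b), x) ↦ H_{t,b} x`.** [folklore] -/
theorem continuous_homMap_apply (U : Set B) (hU : U ⊆ e.baseSet) :
    Continuous fun q : (I × ↥U) × E.F ↦ homMap E e q.1.1 q.1.2 q.2 := by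
  have h1 : Continuous fun q : (I × ↥U) × E.F ↦ locMap E e q.1.2 q.2 :=
    continuous_locMap_apply E e (continuous_subtype_val.comp (continuous_snd.comp continuous_fst)) (fun q ↦ hU q.1.2.2)
      continuous_snd
  have ht : Continuous fun q : (I × ↥U) × E.F ↦ ((q.1.1 : ℝ) : ℂ) :=
    Complex.continuous_ofReal.comp (continuous_subtype_val.comp (continuous_fst.comp continuous_fst))
  have ht' : Continuous fun q : (I × ↥U) × E.F ↦ ((1 - (q.1.1 : ℝ) : ℝ) : ℂ) :=
    Complex.continuous_ofReal.comp (continuous_const.sub (continuous_subtype_val.comp (continuous_fst.comp continuous_fst)))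
  exact (ht.smul h1).add (ht'.smul ((refMap E).continuous.comp continuous_snd))

end Local

/-! ### The map `P(E) → ℙ(K)` and the pure class -/

section Proj

open ComplexVectorBundle

variable {B : Type} [TopologicalSpace B] [T2Space B] [ParacompactSpace B] (E : ComplexVectorBundle.{0, 0} B)

/-- **`P(E) → ℙ(K)`, `⟨b, ℓ⟩ ↦ ℙ(G_b) ℓ`**, the projectivised Gauss map (a classifying-type map of
the canonical line bundle `λ_ξ`; Husemoller Ch. 17 §2). [cite: HusemollerFibreBundles1994, Ch. 17 §2 Thm. 2.5] -/
def gaussProjFun : E.Proj → ℙ ℂ (GH E) := fun p ↦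
  Projectivization.map ((gaussData E).fiberMap p.proj) ((gaussData E).injective p.proj) p.2

/-- **Local formula**: `gaussProjFun ⟨b, ℓ⟩ = ℙ(A_b) (ℙ(ẽ_b) ℓ)` in every trivialisation `e` of the
atlas. [folklore] -/
theorem gaussProjFun_eq (e : Trivialization E.F (π E.F E.E)) [MemTrivializationAtlas e] (p : E.Proj) :
    gaussProjFun E p = Projectivization.map (locMap E e p.proj) (locMap_injective E e p.proj)
      (projTrivialization ℂ E.F E.E e p).2 := by
  rw [projTrivialization_apply, projPretrivialization_apply]
  change _ = Projectivization.map (locMap E e p.proj) (locMap_injective E e p.proj)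
    (Projectivization.map _ (linEquivAt ℂ E.F E.E e p.proj).injective p.2)
  rw [← Function.comp_apply (f := Projectivization.map (locMap E e p.proj) (locMap_injective E e p.proj)),
    ← Projectivization.map_comp]
  exact Projectivization.map_congr (locMap_comp_linEquivAt E e p.proj).symm _ _ _

/-- **The projectivised Gauss map is continuous** (locally it is `(b, ℓ) ↦ ℙ(A_b) ℓ` after the
projectivised trivialisation, with `(b, x) ↦ A_b x` jointly continuous). [folklore] -/
theorem continuous_gaussProjFun : Continuous (gaussProjFun E) := by
  rw [continuous_iff_continuousAt]
  intro p₀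
  let e := trivializationAt E.F E.E p₀.proj
  set U₀ : Set E.Proj := E.projMap ⁻¹' e.baseSet with hU₀
  have hU₀o : IsOpen U₀ := e.open_baseSet.preimage E.projMap.continuous
  have hp₀ : p₀ ∈ U₀ := mem_baseSet_trivializationAt E.F E.E p₀.proj
  -- on `U₀`, the map factors through `↥(baseSet) × ℙ F`
  let ψ : ↥U₀ → ↥(e.baseSet) × ℙ ℂ E.F := fun p ↦ (⟨E.projMap p.1, p.2⟩, (projTrivialization ℂ E.F E.E e p.1).2)
  have hψ : Continuous ψ := by
    refine ((E.projMap.continuous.comp continuous_subtype_val).subtype_mk _).prodMk ?_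
    have hc : ContinuousOn (fun p : E.Proj ↦ (projTrivialization ℂ E.F E.E e p).2) U₀ :=
      (continuous_snd.comp_continuousOn (projTrivialization ℂ E.F E.E e).continuousOn).mono (by
        rw [projTrivialization_source]
        exact fun _ h ↦ h)
    exact hc.comp_continuous continuous_subtype_val fun p ↦ p.2
  let Φ : ↥(e.baseSet) × ℙ ℂ E.F → ℙ ℂ (GH E) := fun y ↦ Projectivization.map (locMap E e y.1) (locMap_injective E e y.1) y.2
  have hΦ : Continuous Φ :=
    continuous_projectivizationMap₂ (fun b : ↥(e.baseSet) ↦ locMap E e b) (fun b ↦ locMap_injective E e b)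
      (continuous_locMap_apply E e (continuous_subtype_val.comp continuous_fst) (fun q ↦ q.1.2) continuous_snd)
  have hfac : (gaussProjFun E) ∘ (Subtype.val : ↥U₀ → E.Proj) = Φ ∘ ψ := funext fun p ↦ gaussProjFun_eq E e p.1
  have hon : ContinuousOn (gaussProjFun E) U₀ := by
    rw [continuousOn_iff_continuous_restrict, show U₀.restrict (gaussProjFun E) = (gaussProjFun E) ∘ Subtype.val from rfl,
      hfac]
    exact hΦ.comp hψ
  exact hon.continuousAt (hU₀o.mem_nhds hp₀)

/-- **The projectivised Gauss map `P(E) → ℙ(K)` as a continuous map.** [cite: HusemollerFibreBundles1994, Ch. 17 §2 Thm. 2.5] -/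
def gaussProj : C(E.Proj, ℙ ℂ (GH E)) := ⟨gaussProjFun E, continuous_gaussProjFun E⟩

/-- **The reference map `ℙ F → ℙ K`, `ℓ ↦ ℙ(refMap) ℓ`.** [folklore] -/
def refProj : C(ℙ ℂ E.F, ℙ ℂ (GH E)) :=
  ⟨Projectivization.map (refMap E : E.F →ₗ[ℂ] GH E) (refMap_injective E),
    continuous_map _ (refMap_injective E) (refMap E).continuous⟩

variable (C : ChernClassTheory)

/-- `c₁^C` of the tautological bundle of `ℙ(K)`. [cite: HusemollerFibreBundles1994, Ch. 17 §3 (3.2)] -/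
def cOneK : singularCohomology ℤ ℤ (ℙ ℂ (GH E)) 2 := C.chernClass (tautologicalBundle (GH E)) 1

/-- **The degree-two class `a = (P(E) → ℙ K)* c₁^C(γ_K) ∈ H²(P(E); ℤ)`** of the Leray–Hirsch
argument (Husemoller Ch. 17 §2: `a_ξ = c₁(λ_ξ)`, pulled back from the universal case).
[cite: HusemollerFibreBundles1994, Ch. 17 §2 Thm. 2.5] -/
def gaussClass : singularCohomology ℤ ℤ E.Proj 2 := singularCohomology.map ℤ ℤ (gaussProj E) 2 (cOneK E C)

/-- **The reference class `x = ℙ(refMap)* c₁^C(γ_K) ∈ H²(ℙ ℂ F; ℤ)`** (the fibre generator). [cite: HusemollerFibreBundles1994, Ch. 17 §2 (2.3)] -/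
def refClass : singularCohomology ℤ ℤ (ℙ ℂ E.F) 2 := singularCohomology.map ℤ ℤ (refProj E) 2 (cOneK E C)

variable (e : Trivialization E.F (π E.F E.E)) [MemTrivializationAtlas e] (U : Set B) (hU : U ⊆ e.baseSet)

/-- **The straight-line homotopy** between `(b, ℓ) ↦ ℙ(refMap) ℓ` and `(b, ℓ) ↦ ℙ(A_b) ℓ`, i.e.
between `refProj ∘ pr₂` and `gaussProj ∘ projChartInv`, through `ℙ(t A_b + (1 - t) refMap)`. [folklore] -/
def gaussHomotopy : ContinuousMap.Homotopy ((refProj E).comp (ContinuousMap.snd : C(↥U × ℙ ℂ E.F, ℙ ℂ E.F)))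
    ((gaussProj E).comp (projChartInv E e U hU)) where
  toFun q := Projectivization.map (homMap E e (q.1 : ℝ) q.2.1) (homMap_injective E e q.1.2.1 q.1.2.2 q.2.1) q.2.2
  continuous_toFun := by
    have h := continuous_projectivizationMap₂ (fun p : I × ↥U ↦ homMap E e (p.1 : ℝ) p.2)
      (fun p ↦ homMap_injective E e p.1.2.1 p.1.2.2 p.2) (continuous_homMap_apply E e U hU)
    exact h.comp ((continuous_fst.prodMk (continuous_fst.comp continuous_snd)).prodMk (continuous_snd.comp continuous_snd))
  map_zero_left q := by
    change Projectivization.map (homMap E e ((0 : I) : ℝ) q.1) (homMap_injective E e (0 : I).2.1 (0 : I).2.2 q.1) q.2 =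
      Projectivization.map (refMap E : E.F →ₗ[ℂ] GH E) (refMap_injective E) q.2
    exact Projectivization.map_congr (by rw [Set.Icc.coe_zero, homMap_zero])
      (homMap_injective E e (0 : I).2.1 (0 : I).2.2 q.1) (refMap_injective E) q.2
  map_one_left q := by
    change Projectivization.map (homMap E e ((1 : I) : ℝ) q.1) _ q.2 = gaussProjFun E (projChartInv E e U hU q)
    rw [gaussProjFun_eq E e, projTrivialization_projChartInv]
    exact Projectivization.map_congr (by rw [Set.Icc.coe_one, homMap_one]; rfl)
      (homMap_injective E e (1 : I).2.1 (1 : I).2.2 q.1) (locMap_injective E e _) q.2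

include hU in
/-- **Purity of the class `a` over a trivialising open set**: on `↥U × ℙ ℂ F ≅ q⁻¹U` the class
`a = gaussClass` is pulled back from the fibre, `(projChartInv)* a = pr₂* x` with `x = refClass`
(homotopy invariance of cohomology, Hatcher §3.1 p. 201; Husemoller Ch. 17 §2: `a_ξ` restricts on
the fibres to the generator). [cite: HusemollerFibreBundles1994, Ch. 17 §2 Thm. 2.5] -/
theorem map_projChartInv_gaussClass :
    singularCohomology.map ℤ ℤ (projChartInv E e U hU) 2 (gaussClass E C) =
      singularCohomology.map ℤ ℤ (ContinuousMap.snd : C(↥U × ℙ ℂ E.F, ℙ ℂ E.F)) 2 (refClass E C) := by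
  rw [gaussClass, refClass, ← ModuleCat.comp_apply, ← singularCohomology.map_comp, ← ModuleCat.comp_apply,
    ← singularCohomology.map_comp]
  exact (ConcreteCategory.congr_hom (singularCohomology.map_eq_of_homotopic' ℤ ℤ ⟨gaussHomotopy E e U hU⟩ 2) (cOneK E C)).symm

/-! ### The reference class generates `H²(ℙ F; ℤ)` -/

/-- `H²(ℂP¹; ℤ) = H²(OnePoint ℂ; ℤ) ≅ ℤ` (through the projective line of `ℂ²`). [cite: HatcherAT2002, Thm. 3.12] -/
theorem nonempty_singularCohomology_onePoint_equiv_int : Nonempty (singularCohomology ℤ ℤ (OnePoint ℂ) 2 ≃ₗ[ℤ] ℤ) := by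
  let V₂ : Type := Fin 2 → ℂ
  let e₀ : V₂ := Pi.single 0 1
  let e₁ : V₂ := Pi.single 1 1
  let φ₀ : StrongDual ℂ V₂ := ContinuousLinearMap.proj 0
  let φ₁ : StrongDual ℂ V₂ := ContinuousLinearMap.proj 1
  have h₀₀ : φ₀ e₀ = 1 := by change (Pi.single (0 : Fin 2) (1 : ℂ) : Fin 2 → ℂ) 0 = 1; simp
  have h₀₁ : φ₀ e₁ = 0 := by change (Pi.single (1 : Fin 2) (1 : ℂ) : Fin 2 → ℂ) 0 = 0; simp
  have h₁₀ : φ₁ e₀ = 0 := by change (Pi.single (0 : Fin 2) (1 : ℂ) : Fin 2 → ℂ) 1 = 0; simp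
  have h₁₁ : φ₁ e₁ = 1 := by change (Pi.single (1 : Fin 2) (1 : ℂ) : Fin 2 → ℂ) 1 = 1; simp
  have h2 : finrank ℂ V₂ = 2 := by simp [V₂]
  obtain ⟨eV⟩ := nonempty_singularCohomology_projectivization_equiv_int (V := V₂) (m := 1) h2 (k := 1) ⟨even_two, le_rfl⟩
  exact ⟨(singularCohomology.mapIso ℤ ℤ (projectiveLineHomeomorph e₀ e₁ φ₀ φ₁ h₀₀ h₀₁ h₁₀ h₁₁ h2) 2).toLinearEquiv.symm.trans eV⟩

/-- In a `ℤ`-line, if `m • y` generates then `m = ±1`. [folklore] -/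
theorem eq_one_or_eq_neg_one_of_span_smul {M : Type*} [AddCommGroup M] [Module ℤ M] (e : M ≃ₗ[ℤ] ℤ) (m : ℤ) (y : M)
    (h : Submodule.span ℤ {m • y} = ⊤) : m = 1 ∨ m = -1 := by
  have h1 := (span_singleton_eq_top_iff_of_equiv e (m • y)).1 h
  have h2 : e (m • y) = m * e y := by rw [map_zsmul, smul_eq_mul]
  rw [h2] at h1
  rcases h1 with h1 | h1
  · exact Int.eq_one_or_neg_one_of_mul_eq_one h1
  · have : m * (-e y) = 1 := by rw [mul_neg, h1, neg_neg]
    exact Int.eq_one_or_neg_one_of_mul_eq_one this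

omit [T2Space B] [ParacompactSpace B] in
/-- **The reference class generates `H²(ℙ ℂ F; ℤ)`** for `rank E ≥ 2`: its restriction along the
projective line through `e₀, e₁` is the restriction of `c₁^C(γ_K)` along the projective line of
`ℙ(K)` through `refMap e₀, refMap e₁`, which is `c₁^C(γ¹)`, a generator ((C₃)); and
`H²(ℙ ℂ F; ℤ) ≅ ℤ ≅ H²(ℂP¹; ℤ)`. [cite: HusemollerFibreBundles1994, Ch. 17 §2 (2.3) and §3 (C₃)] -/
theorem span_refClass_eq_top (hr : 2 ≤ E.rank) : Submodule.span ℤ {refClass E C} = ⊤ := by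
  classical
  -- the line in `ℙ F` through the first two basis vectors
  let i₀ : Fin (Module.finrank ℂ E.F) := ⟨0, by change 0 < E.rank; omega⟩
  let i₁ : Fin (Module.finrank ℂ E.F) := ⟨1, by change 1 < E.rank; omega⟩
  have hi : i₀ ≠ i₁ := fun h ↦ absurd (congrArg Fin.val h) Nat.zero_ne_one
  let e₀ : E.F := Module.finBasis ℂ E.F i₀
  let e₁ : E.F := Module.finBasis ℂ E.F i₁
  let ψ₀ : StrongDual ℂ E.F := fiberCoord i₀
  let ψ₁ : StrongDual ℂ E.F := fiberCoord i₁
  have hψ : ∀ i j : Fin (Module.finrank ℂ E.F), fiberCoord (𝕜 := ℂ) i (Module.finBasis ℂ E.F j) = if j = i then 1 else 0 :=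
    fun i j ↦ by rw [fiberCoord_apply, Module.Basis.repr_self, Finsupp.single_apply]
  have h₀₀ : ψ₀ e₀ = 1 := by rw [show ψ₀ e₀ = _ from hψ i₀ i₀, if_pos rfl]
  have h₀₁ : ψ₀ e₁ = 0 := by rw [show ψ₀ e₁ = _ from hψ i₀ i₁, if_neg hi.symm]
  have h₁₀ : ψ₁ e₀ = 0 := by rw [show ψ₁ e₀ = _ from hψ i₁ i₀, if_neg hi]
  have h₁₁ : ψ₁ e₁ = 1 := by rw [show ψ₁ e₁ = _ from hψ i₁ i₁, if_pos rfl]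
  let ℓF : C(OnePoint ℂ, ℙ ℂ E.F) := projectiveLine e₀ e₁ ψ₀ ψ₁ h₀₀ h₀₁ h₁₀ h₁₁
  -- the corresponding line in `ℙ K`
  let k₀ : GH E := refMap E e₀
  let k₁ : GH E := refMap E e₁
  let φ₀ : StrongDual ℂ (GH E) := innerSL ℂ (lpSingle (Sum.inr i₀ : GIdx E) (1 : ℂ) : GH E)
  let φ₁ : StrongDual ℂ (GH E) := innerSL ℂ (lpSingle (Sum.inr i₁ : GIdx E) (1 : ℂ) : GH E)
  have hφ : ∀ i j : Fin (Module.finrank ℂ E.F),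
      innerSL ℂ (lpSingle (Sum.inr i : GIdx E) (1 : ℂ) : GH E) (refMap E (Module.finBasis ℂ E.F j)) = if j = i then 1 else 0 := by
    intro i j
    rw [innerSL_apply_apply, lpSingle_apply, lp.inner_single_left, refMap_apply_inr, Module.Basis.repr_self,
      Finsupp.single_apply]
    simp
  have g₀₀ : φ₀ k₀ = 1 := by rw [show φ₀ k₀ = _ from hφ i₀ i₀, if_pos rfl]
  have g₀₁ : φ₀ k₁ = 0 := by rw [show φ₀ k₁ = _ from hφ i₀ i₁, if_neg hi.symm]
  have g₁₀ : φ₁ k₀ = 0 := by rw [show φ₁ k₀ = _ from hφ i₁ i₀, if_neg hi]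
  have g₁₁ : φ₁ k₁ = 1 := by rw [show φ₁ k₁ = _ from hφ i₁ i₁, if_pos rfl]
  let ℓK : C(OnePoint ℂ, ℙ ℂ (GH E)) := projectiveLine k₀ k₁ φ₀ φ₁ g₀₀ g₀₁ g₁₀ g₁₁
  -- `refProj ∘ ℓF = ℓK`
  have hline : (refProj E).comp ℓF = ℓK := by
    apply ContinuousMap.ext
    intro z
    induction z using OnePoint.rec with
    | infty =>
      change Projectivization.map (refMap E : E.F →ₗ[ℂ] GH E) (refMap_injective E) (projectiveLine e₀ e₁ ψ₀ ψ₁ h₀₀ h₀₁ h₁₀ h₁₁ ∞) =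
        projectiveLine k₀ k₁ φ₀ φ₁ g₀₀ g₀₁ g₁₀ g₁₁ ∞
      rw [projectiveLine_infty, projectiveLine_infty, Projectivization.map_mk]
      rfl
    | coe t =>
      change Projectivization.map (refMap E : E.F →ₗ[ℂ] GH E) (refMap_injective E) (projectiveLine e₀ e₁ ψ₀ ψ₁ h₀₀ h₀₁ h₁₀ h₁₁ t) =
        projectiveLine k₀ k₁ φ₀ φ₁ g₀₀ g₀₁ g₁₀ g₁₁ t
      rw [projectiveLine_coe, projectiveLine_coe, Projectivization.map_mk]
      congr 1
      change refMap E (t • e₀ + e₁) = t • refMap E e₀ + refMap E e₁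
      rw [map_add, map_smul]
  -- restriction of `c₁^C(γ_K)` along `ℓK` is `c₁^C(γ¹)`
  have hK : singularCohomology.map ℤ ℤ ℓK 2 (cOneK E C) = C.chernClass tautologicalLineBundle 1 := by
    rw [cOneK, C.chernClass_congr (tautologicalLineBundleIsoPullback k₀ k₁ φ₀ φ₁ g₀₀ g₀₁ g₁₀ g₁₁) 1,
      C.chernClass_pullback]
  -- so the restriction of `refClass` along `ℓF` generates `H²(ℂP¹)`
  have hgen : Submodule.span ℤ {singularCohomology.map ℤ ℤ ℓF 2 (refClass E C)} = ⊤ := by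
    rw [refClass, ← ModuleCat.comp_apply, ← singularCohomology.map_comp, hline, hK]
    exact C.span_chernClass_tautological
  -- `H²(ℙ F) ≅ ℤ`, `H²(ℂP¹) ≅ ℤ`: the coordinate `a` of `refClass` is `±1`
  obtain ⟨n, hn⟩ : ∃ n, E.rank = n + 1 + 1 := ⟨E.rank - 2, by omega⟩
  obtain ⟨eF⟩ := nonempty_singularCohomology_projectivization_equiv_int (V := E.F) (m := n + 1) hn (k := 1) ⟨even_two, by omega⟩
  obtain ⟨eP⟩ := nonempty_singularCohomology_onePoint_equiv_int
  set a := eF (refClass E C) with ha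
  set x₀ := eF.symm 1 with hx₀
  have h1 : eF.symm a = a • x₀ := by
    rw [hx₀, ← map_zsmul eF.symm a 1, zsmul_eq_mul, mul_one, Int.cast_id]
  have hre : refClass E C = a • x₀ := by rw [← h1, ha, LinearEquiv.symm_apply_apply]
  have hy : singularCohomology.map ℤ ℤ ℓF 2 (refClass E C) = a • singularCohomology.map ℤ ℤ ℓF 2 x₀ := by
    rw [hre, map_zsmul]
  rw [hy] at hgen
  have hm := eq_one_or_eq_neg_one_of_span_smul eP a _ hgen
  refine (span_singleton_eq_top_iff_of_equiv eF (refClass E C)).2 ?_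
  rw [← ha]
  exact hm

end Proj

end Literature.AlgebraicTopology.CharacteristicClasses
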